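import Summits.BirchSwinnertonDyer.BirchSwinnertonDyer.Theorems.AlignedTransportAtTwoMainConjectureOfRankZeroBSDAtTwoCubicOrderFourRowN4307
import Summits.BirchSwinnertonDyer.BirchSwinnertonDyer.Theorems.AlignedTransportAtTwoMainConjectureOfRankZeroBSDAtTwoCubicOrderFourExactDoor
import Literature.NumberTheory.NumberFields.CubicFieldResiduePrimes
import HarnessLib

/-!
# Route `AlignedTransportAtTwo`, crux C2 `MainConjectureOfRankZeroBSDAtTwo` (stmt-BirchSwinnertonDyer-22298):
# `e₁ = ord₂ h(ℚ(β,√2)) = 2` EXACTLY, IN THE KERNEL, for the cubic `2`-torsion field of `⟨1, 0, 0, -3, -4⟩` (`N = 4307`) — the order-four certificate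
# (rows `…RowN4307{Data,Certs,}`: `e₁ ≥ 2`) plus ONE genus bit: the split prime `q₀` under the order-four ideal has `q₀ ≡ ±3 (mod 𝔭₁³)`

HONEST FRAMING (cell `bsd-f1-sign2`, WIDTH-5 attached prover seat `bsd-line-att-p4` gen 40 on line `birth` of the lead `bsd-line-att-p2`;
`--supports` stmt-BirchSwinnertonDyer-22298, closes nothing; BSD is NOT proved by any of this; the crux C2, its verdict «blocked-on
`Rank1Residual.GreenbergMuConjectureIrreducible`» and every registered stub are untouched).  THEOREMS ONLY (no `def`, no named fact, no instance, no `sorry`).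

WHAT.  Part 4 of the row `N = 4307`: parts 1–3 proved `e₁ ≥ 2` (a class of order `4` in `Cl(K₁)`, `K₁ = ℚ(β,√2)`).  Here the UPPER bound: by this seat's exact
door (`…CubicOrderFourExactDoor`, Literature `NumberFields/QuadraticSqrtTwoOrderFourClassNotSquare` + `IwasawaTheory/ClassNumberPExpLayerOneEqTwoOfOrderFourCertificate`)
the order-four class `[(q₀, √2 − 4)]` is NOT a square in `Cl(K₁)` because its relative norm `(q₀)` has genus bit `(q₀, 2)_{𝔭₁} = −1`, i.e.
`q₀ − 3 ∈ 𝔭₁³` (`𝔭₁ = (-4 + θ)` the dyadic prime of norm `2`, `N(𝔭₁) = 2` by the residue map `θ ↦ 0 (mod 2)`), while every unit of `ℚ(β)` is `≡ ±1 (mod 𝔭₁³)`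
(u7: the unit `ε = 3463 + 1232θ + 1354θ²` of odd index — `±ε` non-squares by the residue map mod `5` — has `ε + 1 ∈ 𝔭₁³`) and `N_{K₁/ℚ(β)}(w) = A² − 2B² = u·q₀⁴`
with the unit `u = -100354409 − 35702196θ − 39237556θ²`; `rank₂ Cl(K₁) ≤ 1` (Gras; `Δ_min ≡ 5 (mod 8)`: two primes above `2`).  THEN (★ `classNumberPExp_one_cubicField_n4307_eq_two`)
`e₁(κ) = 2` for every cyclotomic `ℤ₂`-extension `κ` of `ℚ(β)` — UNCONDITIONAL; `Cl(K₁)[2^∞] ≅ ℤ/4` (the S-unit relation lattice said `h(K₁) = 4`).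
Nothing is asserted about `μ₂` or `MC₂` for this curve; BSD is NOT proved; nothing is closed.

References: [Gras2003] IV.4; [Serre1973CourseArithmetic] Ch. III §1.2 Thm. 1; [NeukirchANT1999] I §3, §7 (7.4), §8, III §1 (1.6); [Cohen1993] §6.5;
[Marcus2018] Ch. 3 Thm. 27; [LMFDB] nf 3.1.4307.1, ec 4307; tree: this seat's `…CubicOrderFourExactDoor`, `…RowN4307{Data,Certs,}`, `CubicDoorsDeadSubcellClassNumberB`, `CubicDisc4307`.
-/

set_option linter.dupNamespace false
set_option autoImplicit false

noncomputable section

open scoped Classical NumberField nonZeroDivisors IntermediateField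

namespace Summit.BirchSwinnertonDyer.BirchSwinnertonDyer.Theorems.AlignedTransportAtTwoCubicOrderFourRowN4307

open NumberField IsDedekindDomain Polynomial WeierstrassCurve IntermediateField CongruenceSubgroup Module
  Literature.NumberTheory.IwasawaTheory Literature.NumberTheory.GaloisRepresentations
  Literature.NumberTheory.EllipticCurves Literature.NumberTheory.EllipticCurves.Greenberg1999
  Literature.NumberTheory.EllipticCurves.ModularForms Literature.NumberTheory.EllipticCurves.Rank1Residual
  Literature.NumberTheory.EllipticCurves.Module
  Literature.NumberTheory.NumberFields Literature.NumberTheory.CubicFields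
  Summit.BirchSwinnertonDyer.Rank1Residual Summit.BirchSwinnertonDyer.Rank1Residual.X1.MuLambda
  Summit.BirchSwinnertonDyer.Rank1Residual.X5 Summit.BirchSwinnertonDyer.Rank1Residual.X5.O1
  Summit.BirchSwinnertonDyer.Rank1Residual.X5.Instances Summit.BirchSwinnertonDyer.Rank1Residual.F1Sign2
  Summit.BirchSwinnertonDyer.BirchSwinnertonDyer.Theorems.Rank1ResidualX1Defs
  Summit.BirchSwinnertonDyer.BirchSwinnertonDyer.Theses.AlignedTransportAtTwo
  Summit.BirchSwinnertonDyer.BirchSwinnertonDyer.Theorems.AlignedTransportAtTwoCubicOrderFourDoor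
  Summit.BirchSwinnertonDyer.BirchSwinnertonDyer.Theorems.AlignedTransportAtTwoCubicDoorsDeadSubcellClassNumberB

/-- The residue map `ψ₂ : 𝓞_{ℚ(β)} → ℤ/2` with `ψ₂(θ) = 0` (the degree-one dyadic prime `𝔭₁ = (2, θ + 0)`). [cite: Marcus2018, Ch. 3, Thm. 27] -/
theorem exists_residueHom_two_n4307 {β : AlgebraicClosure ℚ} (hβ : aeval β ((⟨1, 0, 0, -3, -4⟩ : WeierstrassCurve ℤ).baseChange ℚ).twoTorsionPolynomial.toPoly = 0) :
    ∃ ψ : 𝓞 ↥(IntermediateField.adjoin ℚ ({β} : Set (AlgebraicClosure ℚ))) →+* ZMod 2, ψ (MonicCubic.thetaInt (aeval_theta_n4307 hβ)) = (((0) : ℤ) : ZMod 2) :=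
  haveI : FiniteDimensional ℚ ↥(IntermediateField.adjoin ℚ ({β} : Set (AlgebraicClosure ℚ))) := IntermediateField.adjoin.finiteDimensional ((AlgebraicClosure.isAlgebraic ℚ).isAlgebraic β).isIntegral
  haveI : NumberField ↥(IntermediateField.adjoin ℚ ({β} : Set (AlgebraicClosure ℚ))) := NumberField.mk
  MonicCubic.exists_ringHom_of_root CubicDisc4307.irreducible_polyQ (aeval_theta_n4307 hβ) (finrank_cubicField_n4307 hβ)
    CubicDisc4307.isUnit_of_disc_eq_sq_mul (((0) : ℤ) : ZMod 2) (by decide)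

/-- **`N(𝔭₁) = 2`** for `𝔭₁ = (-4 + θ)`: `(2, θ + 0) = (-4 + θ)` (tree `CubicDisc4307.span_2_lin0_eq`) is the kernel of `ψ₂`, of index `2`.
[cite: Marcus2018, Ch. 3, Thm. 27] [cite: LMFDB, number field 3.1.4307.1] -/
theorem absNorm_span_pi1_n4307 {β : AlgebraicClosure ℚ} (hβ : aeval β ((⟨1, 0, 0, -3, -4⟩ : WeierstrassCurve ℤ).baseChange ℚ).twoTorsionPolynomial.toPoly = 0) :
    haveI : FiniteDimensional ℚ ↥(IntermediateField.adjoin ℚ ({β} : Set (AlgebraicClosure ℚ))) := IntermediateField.adjoin.finiteDimensional ((AlgebraicClosure.isAlgebraic ℚ).isAlgebraic β).isIntegral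
    haveI : NumberField ↥(IntermediateField.adjoin ℚ ({β} : Set (AlgebraicClosure ℚ))) := NumberField.mk
    Ideal.absNorm (Ideal.span {((-4 : 𝓞 ↥(IntermediateField.adjoin ℚ ({β} : Set (AlgebraicClosure ℚ)))) + (1 : 𝓞 ↥(IntermediateField.adjoin ℚ ({β} : Set (AlgebraicClosure ℚ)))) * MonicCubic.thetaInt (aeval_theta_n4307 hβ) + (0 : 𝓞 ↥(IntermediateField.adjoin ℚ ({β} : Set (AlgebraicClosure ℚ)))) * MonicCubic.thetaInt (aeval_theta_n4307 hβ) ^ 2)}) = 2 := by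
  haveI : FiniteDimensional ℚ ↥(IntermediateField.adjoin ℚ ({β} : Set (AlgebraicClosure ℚ))) := IntermediateField.adjoin.finiteDimensional ((AlgebraicClosure.isAlgebraic ℚ).isAlgebraic β).isIntegral
  haveI : NumberField ↥(IntermediateField.adjoin ℚ ({β} : Set (AlgebraicClosure ℚ))) := NumberField.mk
  haveI : Fact (Nat.Prime 2) := ⟨Nat.prime_two⟩
  have hθ := aeval_theta_n4307 hβ
  have h3 := finrank_cubicField_n4307 hβ
  obtain ⟨ψ, hψ⟩ := exists_residueHom_two_n4307 hβ
  have hexp : ¬ 2 ∣ RingOfIntegers.exponent (MonicCubic.thetaInt hθ) := by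
    rw [MonicCubic.exponent_thetaInt CubicDisc4307.irreducible_polyQ hθ h3 CubicDisc4307.isUnit_of_disc_eq_sq_mul]; decide
  have hker := MonicCubic.ker_residueHom_eq_span CubicDisc4307.irreducible_polyQ hθ hexp ψ hψ
  have hspan : Ideal.span {((2 : ℕ) : 𝓞 ↥(IntermediateField.adjoin ℚ ({β} : Set (AlgebraicClosure ℚ)))), MonicCubic.thetaInt hθ - (((0) : ℤ) : 𝓞 ↥(IntermediateField.adjoin ℚ ({β} : Set (AlgebraicClosure ℚ))))} = Ideal.span {((-4 : 𝓞 ↥(IntermediateField.adjoin ℚ ({β} : Set (AlgebraicClosure ℚ)))) + (1 : 𝓞 ↥(IntermediateField.adjoin ℚ ({β} : Set (AlgebraicClosure ℚ)))) * MonicCubic.thetaInt (aeval_theta_n4307 hβ) + (0 : 𝓞 ↥(IntermediateField.adjoin ℚ ({β} : Set (AlgebraicClosure ℚ)))) * MonicCubic.thetaInt (aeval_theta_n4307 hβ) ^ 2)} := by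
    rw [Nat.cast_ofNat, show MonicCubic.thetaInt hθ - (((0) : ℤ) : 𝓞 ↥(IntermediateField.adjoin ℚ ({β} : Set (AlgebraicClosure ℚ)))) = MonicCubic.thetaInt hθ  by push_cast; ring,
      show (((-4 : 𝓞 ↥(IntermediateField.adjoin ℚ ({β} : Set (AlgebraicClosure ℚ)))) + (1 : 𝓞 ↥(IntermediateField.adjoin ℚ ({β} : Set (AlgebraicClosure ℚ)))) * MonicCubic.thetaInt (aeval_theta_n4307 hβ) + (0 : 𝓞 ↥(IntermediateField.adjoin ℚ ({β} : Set (AlgebraicClosure ℚ)))) * MonicCubic.thetaInt (aeval_theta_n4307 hβ) ^ 2)) = -4 + MonicCubic.thetaInt hθ by ring]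
    exact CubicDisc4307.span_2_lin0_eq hθ
  rw [← hspan, ← hker]
  exact absNorm_ker_zmod ψ

/-- A ring homomorphism `ψ : 𝓞_{ℚ(β)} → ℤ/5` with `ψ(θ) = 0` (`5 ≡ 1 (mod 4)`; `ε ↦ 3`, a non-residue, so `±ε` are non-squares). [cite: Marcus2018, Ch. 3, Thm. 27] -/
theorem exists_residueHom_eps_n4307 {β : AlgebraicClosure ℚ} (hβ : aeval β ((⟨1, 0, 0, -3, -4⟩ : WeierstrassCurve ℤ).baseChange ℚ).twoTorsionPolynomial.toPoly = 0) :
    ∃ ψ : 𝓞 ↥(IntermediateField.adjoin ℚ ({β} : Set (AlgebraicClosure ℚ))) →+* ZMod 5, ψ (MonicCubic.thetaInt (aeval_theta_n4307 hβ)) = (0 : ZMod 5) :=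
  haveI : FiniteDimensional ℚ ↥(IntermediateField.adjoin ℚ ({β} : Set (AlgebraicClosure ℚ))) := IntermediateField.adjoin.finiteDimensional ((AlgebraicClosure.isAlgebraic ℚ).isAlgebraic β).isIntegral
  haveI : NumberField ↥(IntermediateField.adjoin ℚ ({β} : Set (AlgebraicClosure ℚ))) := NumberField.mk
  MonicCubic.exists_ringHom_of_root CubicDisc4307.irreducible_polyQ (aeval_theta_n4307 hβ) (finrank_cubicField_n4307 hβ)
    CubicDisc4307.isUnit_of_disc_eq_sq_mul (0 : ZMod 5) (by decide)

/-! ## `e₁ = 2` exactly for the cubic field of discriminant `−4307` — UNCONDITIONAL -/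

/-- ★ **`e₁ = ord₂ h(ℚ(β,√2)) = 2` EXACTLY** for the cubic `2`-torsion field of `⟨1, 0, 0, -3, -4⟩` (discriminant `−4307`) and every cyclotomic `ℤ₂`-extension `κ`:
the order-four certificate of parts 1–3 (`e₁ ≥ 2`) and the genus bit `q₀ − 3 ∈ 𝔭₁³` of the split prime `q₀` of norm `7` under the order-four ideal
(its class is not a square), with `rank₂ Cl(ℚ(β,√2)) ≤ 1`. [cite: Gras2003, IV.4] [cite: Serre1973CourseArithmetic, Ch. III §1.2, Thm. 1]
[cite: NeukirchANT1999, Ch. I §7 Thm. (7.4), Ch. III §1 (1.6)] [cite: Cohen1993, §6.5] [cite: LMFDB, number field 3.1.4307.1; elliptic curve 4307] -/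
theorem classNumberPExp_one_cubicField_n4307_eq_two {β : AlgebraicClosure ℚ} (hβ : aeval β ((⟨1, 0, 0, -3, -4⟩ : WeierstrassCurve ℤ).baseChange ℚ).twoTorsionPolynomial.toPoly = 0)
    (κP : ZpExtension ↥(IntermediateField.adjoin ℚ ({β} : Set (AlgebraicClosure ℚ))) 2) (hκP : κP.IsCyclotomic) :
    classNumberPExp κP 1 = 2 := by
  haveI := isElliptic_n4307
  haveI := isGloballyMinimal_n4307
  haveI : FiniteDimensional ℚ ↥(IntermediateField.adjoin ℚ ({β} : Set (AlgebraicClosure ℚ))) := IntermediateField.adjoin.finiteDimensional ((AlgebraicClosure.isAlgebraic ℚ).isAlgebraic β).isIntegral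
  haveI : NumberField ↥(IntermediateField.adjoin ℚ ({β} : Set (AlgebraicClosure ℚ))) := NumberField.mk
  have hord : IsOrdinaryAt ((⟨1, 0, 0, -3, -4⟩ : WeierstrassCurve ℤ).baseChange ℚ) 2 := goodOrd_two_n4307
  have ht := not_hasRationalTwoTorsionX_n4307
  have hd : ¬ (2 : ℤ) ∣ NumberField.discr ↥(IntermediateField.adjoin ℚ ({β} : Set (AlgebraicClosure ℚ))) := by
    rw [CubicDisc4307.discr_eq (finrank_cubicField_n4307 hβ) (aeval_theta_n4307 hβ)]; norm_num
  obtain ⟨ψ, hψ⟩ := exists_residueHom_eps_n4307 hβ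
  set θI : 𝓞 ↥(IntermediateField.adjoin ℚ ({β} : Set (AlgebraicClosure ℚ))) := MonicCubic.thetaInt (aeval_theta_n4307 hβ) with hθI
  have hrel : θI ^ 3 + (-3 : 𝓞 ↥(IntermediateField.adjoin ℚ ({β} : Set (AlgebraicClosure ℚ)))) * θI ^ 2 + (-1 : 𝓞 ↥(IntermediateField.adjoin ℚ ({β} : Set (AlgebraicClosure ℚ)))) * θI + (-10 : 𝓞 ↥(IntermediateField.adjoin ℚ ({β} : Set (AlgebraicClosure ℚ)))) = 0 := by
    have h := MonicCubic.thetaInt_rel (aeval_theta_n4307 hβ)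
    rw [← hθI] at h
    push_cast at h
    linear_combination h
  have hεmul : ((3463 : 𝓞 ↥(IntermediateField.adjoin ℚ ({β} : Set (AlgebraicClosure ℚ)))) + (1232 : 𝓞 ↥(IntermediateField.adjoin ℚ ({β} : Set (AlgebraicClosure ℚ)))) * θI + (1354 : 𝓞 ↥(IntermediateField.adjoin ℚ ({β} : Set (AlgebraicClosure ℚ)))) * θI ^ 2) * ((-113 : 𝓞 ↥(IntermediateField.adjoin ℚ ({β} : Set (AlgebraicClosure ℚ)))) + (68 : 𝓞 ↥(IntermediateField.adjoin ℚ ({β} : Set (AlgebraicClosure ℚ)))) * θI + (-10 : 𝓞 ↥(IntermediateField.adjoin ℚ ({β} : Set (AlgebraicClosure ℚ)))) * θI ^ 2) = 1 := by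
    linear_combination ((39132 : 𝓞 ↥(IntermediateField.adjoin ℚ ({β} : Set (AlgebraicClosure ℚ)))) * θI ^ 0 + (-13540 : 𝓞 ↥(IntermediateField.adjoin ℚ ({β} : Set (AlgebraicClosure ℚ)))) * θI ^ 1) * hrel
  have hψε : ψ ((3463 : 𝓞 ↥(IntermediateField.adjoin ℚ ({β} : Set (AlgebraicClosure ℚ)))) + (1232 : 𝓞 ↥(IntermediateField.adjoin ℚ ({β} : Set (AlgebraicClosure ℚ)))) * θI + (1354 : 𝓞 ↥(IntermediateField.adjoin ℚ ({β} : Set (AlgebraicClosure ℚ)))) * θI ^ 2) = (3 : ZMod 5) := by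
    simp only [map_add, map_mul, map_pow, map_ofNat, hψ]
    decide
  have hnsq : ∀ z : (𝓞 ↥(IntermediateField.adjoin ℚ ({β} : Set (AlgebraicClosure ℚ))))ˣ, Units.mkOfMulEqOne _ _ hεmul ≠ z ^ 2 ∧ Units.mkOfMulEqOne _ _ hεmul ≠ -z ^ 2 := by
    intro z
    refine ⟨fun h => ?_, fun h => ?_⟩
    · have h' := congrArg (fun w : (𝓞 ↥(IntermediateField.adjoin ℚ ({β} : Set (AlgebraicClosure ℚ))))ˣ => ψ (w : 𝓞 ↥(IntermediateField.adjoin ℚ ({β} : Set (AlgebraicClosure ℚ))))) h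
      simp only [Units.val_mkOfMulEqOne, Units.val_pow_eq_pow_val, map_pow] at h'
      rw [hψε] at h'
      exact absurd h'.symm (by generalize ψ (z : 𝓞 ↥(IntermediateField.adjoin ℚ ({β} : Set (AlgebraicClosure ℚ)))) = t; revert t; decide)
    · have h' := congrArg (fun w : (𝓞 ↥(IntermediateField.adjoin ℚ ({β} : Set (AlgebraicClosure ℚ))))ˣ => ψ (w : 𝓞 ↥(IntermediateField.adjoin ℚ ({β} : Set (AlgebraicClosure ℚ))))) h
      simp only [Units.val_mkOfMulEqOne, Units.val_neg, Units.val_pow_eq_pow_val, map_neg, map_pow] at h'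
      rw [hψε] at h'
      exact absurd h'.symm (by generalize ψ (z : 𝓞 ↥(IntermediateField.adjoin ℚ ({β} : Set (AlgebraicClosure ℚ)))) = t; revert t; decide)
  have hε : (Units.mkOfMulEqOne _ _ hεmul : (𝓞 ↥(IntermediateField.adjoin ℚ ({β} : Set (AlgebraicClosure ℚ))))ˣ).val - 1 ∈ Ideal.span {((-4 : 𝓞 ↥(IntermediateField.adjoin ℚ ({β} : Set (AlgebraicClosure ℚ)))) + (1 : 𝓞 ↥(IntermediateField.adjoin ℚ ({β} : Set (AlgebraicClosure ℚ)))) * θI + (0 : 𝓞 ↥(IntermediateField.adjoin ℚ ({β} : Set (AlgebraicClosure ℚ)))) * θI ^ 2)} ^ 3 ∨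
      (Units.mkOfMulEqOne _ _ hεmul : (𝓞 ↥(IntermediateField.adjoin ℚ ({β} : Set (AlgebraicClosure ℚ))))ˣ).val + 1 ∈ Ideal.span {((-4 : 𝓞 ↥(IntermediateField.adjoin ℚ ({β} : Set (AlgebraicClosure ℚ)))) + (1 : 𝓞 ↥(IntermediateField.adjoin ℚ ({β} : Set (AlgebraicClosure ℚ)))) * θI + (0 : 𝓞 ↥(IntermediateField.adjoin ℚ ({β} : Set (AlgebraicClosure ℚ)))) * θI ^ 2)} ^ 3 := by
    refine Or.inr ?_
    rw [Units.val_mkOfMulEqOne, Ideal.span_singleton_pow, Ideal.mem_span_singleton']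
    exact ⟨((-4734486 : 𝓞 ↥(IntermediateField.adjoin ℚ ({β} : Set (AlgebraicClosure ℚ)))) + (-1684346 : 𝓞 ↥(IntermediateField.adjoin ℚ ({β} : Set (AlgebraicClosure ℚ)))) * θI + (-1851136 : 𝓞 ↥(IntermediateField.adjoin ℚ ({β} : Set (AlgebraicClosure ℚ)))) * θI ^ 2), by linear_combination ((-30300364 : 𝓞 ↥(IntermediateField.adjoin ℚ ({β} : Set (AlgebraicClosure ℚ)))) * θI ^ 0 + (14975878 : 𝓞 ↥(IntermediateField.adjoin ℚ ({β} : Set (AlgebraicClosure ℚ)))) * θI ^ 1 + (-1851136 : 𝓞 ↥(IntermediateField.adjoin ℚ ({β} : Set (AlgebraicClosure ℚ)))) * θI ^ 2) * hrel⟩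
  have huw : ((-100354409 : 𝓞 ↥(IntermediateField.adjoin ℚ ({β} : Set (AlgebraicClosure ℚ)))) + (-35702196 : 𝓞 ↥(IntermediateField.adjoin ℚ ({β} : Set (AlgebraicClosure ℚ)))) * θI + (-39237556 : 𝓞 ↥(IntermediateField.adjoin ℚ ({β} : Set (AlgebraicClosure ℚ)))) * θI ^ 2) * ((-2169 : 𝓞 ↥(IntermediateField.adjoin ℚ ({β} : Set (AlgebraicClosure ℚ)))) + (15428 : 𝓞 ↥(IntermediateField.adjoin ℚ ({β} : Set (AlgebraicClosure ℚ)))) * θI + (-3804 : 𝓞 ↥(IntermediateField.adjoin ℚ ({β} : Set (AlgebraicClosure ℚ)))) * θI ^ 2) = 1 := by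
    linear_combination ((-21766871312 : 𝓞 ↥(IntermediateField.adjoin ℚ ({β} : Set (AlgebraicClosure ℚ)))) * θI ^ 0 + (149259663024 : 𝓞 ↥(IntermediateField.adjoin ℚ ({β} : Set (AlgebraicClosure ℚ)))) * θI ^ 1) * hrel
  have hNw : ((1 : 𝓞 ↥(IntermediateField.adjoin ℚ ({β} : Set (AlgebraicClosure ℚ)))) + (-2 : 𝓞 ↥(IntermediateField.adjoin ℚ ({β} : Set (AlgebraicClosure ℚ)))) * θI + (-1 : 𝓞 ↥(IntermediateField.adjoin ℚ ({β} : Set (AlgebraicClosure ℚ)))) * θI ^ 2) ^ 2 - 2 * ((-5 : 𝓞 ↥(IntermediateField.adjoin ℚ ({β} : Set (AlgebraicClosure ℚ)))) + (0 : 𝓞 ↥(IntermediateField.adjoin ℚ ({β} : Set (AlgebraicClosure ℚ)))) * θI + (-1 : 𝓞 ↥(IntermediateField.adjoin ℚ ({β} : Set (AlgebraicClosure ℚ)))) * θI ^ 2) ^ 2 = (Units.mkOfMulEqOne _ _ huw : (𝓞 ↥(IntermediateField.adjoin ℚ ({β} : Set (AlgebraicClosure ℚ))))ˣ).val * ((-11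 : 𝓞 ↥(IntermediateField.adjoin ℚ ({β} : Set (AlgebraicClosure ℚ)))) + (-5 : 𝓞 ↥(IntermediateField.adjoin ℚ ({β} : Set (AlgebraicClosure ℚ)))) * θI + (2 : 𝓞 ↥(IntermediateField.adjoin ℚ ({β} : Set (AlgebraicClosure ℚ)))) * θI ^ 2) ^ 4 := by
    rw [Units.val_mkOfMulEqOne]
    linear_combination ((-146928890212 : 𝓞 ↥(IntermediateField.adjoin ℚ ({β} : Set (AlgebraicClosure ℚ)))) * θI ^ 0 + (-304722132900 : 𝓞 ↥(IntermediateField.adjoin ℚ ({β} : Set (AlgebraicClosure ℚ)))) * θI ^ 1 + (-153221948768 : 𝓞 ↥(IntermediateField.adjoin ℚ ({β} : Set (AlgebraicClosure ℚ)))) * θI ^ 2 + (51331461132 : 𝓞 ↥(IntermediateField.adjoin ℚ ({β} : Set (AlgebraicClosure ℚ)))) * θI ^ 3 + (43947430512 : 𝓞 ↥(IntermediateField.adjoin ℚ ({β} : Set (AlgebraicClosure ℚ)))) * θI ^ 4 + (-5218079440 : 𝓞 ↥(IntermediateField.adjoin ℚ ({β} : Set (AlgebraicClosure ℚ)))) *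 θI ^ 5 + (-3823371136 : 𝓞 ↥(IntermediateField.adjoin ℚ ({β} : Set (AlgebraicClosure ℚ)))) * θI ^ 6 + (627800896 : 𝓞 ↥(IntermediateField.adjoin ℚ ({β} : Set (AlgebraicClosure ℚ)))) * θI ^ 7) * hrel
  have hq : ((-11 : 𝓞 ↥(IntermediateField.adjoin ℚ ({β} : Set (AlgebraicClosure ℚ)))) + (-5 : 𝓞 ↥(IntermediateField.adjoin ℚ ({β} : Set (AlgebraicClosure ℚ)))) * θI + (2 : 𝓞 ↥(IntermediateField.adjoin ℚ ({β} : Set (AlgebraicClosure ℚ)))) * θI ^ 2) - 3 ∈ Ideal.span {((-4 : 𝓞 ↥(IntermediateField.adjoin ℚ ({β} : Set (AlgebraicClosure ℚ)))) + (1 : 𝓞 ↥(IntermediateField.adjoin ℚ ({β} : Set (AlgebraicClosure ℚ)))) * θI + (0 : 𝓞 ↥(IntermediateField.adjoin ℚ ({β} : Set (AlgebraicClosure ℚ)))) * θI ^ 2)} ^ 3 ∨ ((-11 : 𝓞 ↥(IntermediateField.adjoin ℚ ({β} : Set (AlgebraicClosure ℚ)))) + (-5 : 𝓞 ↥(IntermediateField.adjoin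 ℚ ({β} : Set (AlgebraicClosure ℚ)))) * θI + (2 : 𝓞 ↥(IntermediateField.adjoin ℚ ({β} : Set (AlgebraicClosure ℚ)))) * θI ^ 2) + 3 ∈ Ideal.span {((-4 : 𝓞 ↥(IntermediateField.adjoin ℚ ({β} : Set (AlgebraicClosure ℚ)))) + (1 : 𝓞 ↥(IntermediateField.adjoin ℚ ({β} : Set (AlgebraicClosure ℚ)))) * θI + (0 : 𝓞 ↥(IntermediateField.adjoin ℚ ({β} : Set (AlgebraicClosure ℚ)))) * θI ^ 2)} ^ 3 := by
    refine Or.inl ?_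
    rw [Ideal.span_singleton_pow, Ideal.mem_span_singleton']
    exact ⟨((486 : 𝓞 ↥(IntermediateField.adjoin ℚ ({β} : Set (AlgebraicClosure ℚ)))) + (173 : 𝓞 ↥(IntermediateField.adjoin ℚ ({β} : Set (AlgebraicClosure ℚ)))) * θI + (190 : 𝓞 ↥(IntermediateField.adjoin ℚ ({β} : Set (AlgebraicClosure ℚ)))) * θI ^ 2), by linear_combination ((3109 : 𝓞 ↥(IntermediateField.adjoin ℚ ({β} : Set (AlgebraicClosure ℚ)))) * θI ^ 0 + (-1537 : 𝓞 ↥(IntermediateField.adjoin ℚ ({β} : Set (AlgebraicClosure ℚ)))) * θI ^ 1 + (190 : 𝓞 ↥(IntermediateField.adjoin ℚ ({β} : Set (AlgebraicClosure ℚ)))) * θI ^ 2) * hrel⟩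
  have hcert : ∀ (e₁ e₂ e₃ e₄ : ℕ) (σ : ℤˣ), e₁ ≤ 1 → e₂ ≤ 1 → e₃ ≤ 1 → e₄ ≤ 1 →
      ¬ (e₁ = 0 ∧ e₂ = 0 ∧ e₃ = 0 ∧ e₄ = 0 ∧ σ = 1) →
      ∃ (q : ℕ) (ψ : 𝓞 ↥(IntermediateField.adjoin ℚ ({β} : Set (AlgebraicClosure ℚ))) →+* ZMod q) (t : ZMod q) (ρ : 𝓞 ↥(IntermediateField.adjoin ℚ ({β} : Set (AlgebraicClosure ℚ)))), 2 * t = 1 ∧ ψ ρ ^ 2 = 2 ∧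
        ¬ IsSquare (((σ : ℤ) : ZMod q) * (ψ ((1 : 𝓞 ↥(IntermediateField.adjoin ℚ ({β} : Set (AlgebraicClosure ℚ)))) + (0 : 𝓞 ↥(IntermediateField.adjoin ℚ ({β} : Set (AlgebraicClosure ℚ)))) * θI + (0 : 𝓞 ↥(IntermediateField.adjoin ℚ ({β} : Set (AlgebraicClosure ℚ)))) * θI ^ 2) + ψ ((1 : 𝓞 ↥(IntermediateField.adjoin ℚ ({β} : Set (AlgebraicClosure ℚ)))) + (0 : 𝓞 ↥(IntermediateField.adjoin ℚ ({β} : Set (AlgebraicClosure ℚ)))) * θI + (0 : 𝓞 ↥(IntermediateField.adjoin ℚ ({β} : Set (AlgebraicClosure ℚ)))) * θI ^ 2) * ψ ρ) ^ e₁ * (ψ ((17 : 𝓞 ↥(IntermediateField.adjoin ℚ ({β} : Set (AlgebraicClosure ℚ)))) + (36 : 𝓞 ↥(IntermediateField.adjoin ℚ ({β} : Set (AlgebraicClosure ℚ)))) * θI + (124 : 𝓞 ↥(IntermediateField.adjoin ℚ ({β} : Set (AlgebraicClosure ℚ)))) * θI ^ 2) + ψ ((335 : 𝓞 ↥(IntermediateField.adjoin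 ℚ ({β} : Set (AlgebraicClosure ℚ)))) + (98 : 𝓞 ↥(IntermediateField.adjoin ℚ ({β} : Set (AlgebraicClosure ℚ)))) * θI + (48 : 𝓞 ↥(IntermediateField.adjoin ℚ ({β} : Set (AlgebraicClosure ℚ)))) * θI ^ 2) * ψ ρ) ^ e₂ * (ψ ((175 : 𝓞 ↥(IntermediateField.adjoin ℚ ({β} : Set (AlgebraicClosure ℚ)))) + (60 : 𝓞 ↥(IntermediateField.adjoin ℚ ({β} : Set (AlgebraicClosure ℚ)))) * θI + (68 : 𝓞 ↥(IntermediateField.adjoin ℚ ({β} : Set (AlgebraicClosure ℚ)))) * θI ^ 2) + ψ ((-122 : 𝓞 ↥(IntermediateField.adjoin ℚ ({β} : Set (AlgebraicClosure ℚ)))) + (-45 : 𝓞 ↥(IntermediateField.adjoin ℚ ({β} : Set (AlgebraicClosure ℚ)))) * θI + (-48 : 𝓞 ↥(IntermediateField.adjoin ℚ ({β} : Set (AlgebraicClosure ℚ)))) * θI ^ 2) * ψ ρ) ^ e₃ * (ψ ((1 : 𝓞 ↥(IntermediateField.adjoin ℚ ({β} : Set (AlgebraicClosure ℚ)))) + (-2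 : 𝓞 ↥(IntermediateField.adjoin ℚ ({β} : Set (AlgebraicClosure ℚ)))) * θI + (-1 : 𝓞 ↥(IntermediateField.adjoin ℚ ({β} : Set (AlgebraicClosure ℚ)))) * θI ^ 2) + ψ ((-5 : 𝓞 ↥(IntermediateField.adjoin ℚ ({β} : Set (AlgebraicClosure ℚ)))) + (0 : 𝓞 ↥(IntermediateField.adjoin ℚ ({β} : Set (AlgebraicClosure ℚ)))) * θI + (-1 : 𝓞 ↥(IntermediateField.adjoin ℚ ({β} : Set (AlgebraicClosure ℚ)))) * θI ^ 2) * ψ ρ) ^ e₄) := by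
    intro e₁ e₂ e₃ e₄ σ h₁ h₂ h₃ h₄ hne
    rcases Nat.le_one_iff_eq_zero_or_eq_one.mp h₁ with rfl | rfl <;>
    rcases Nat.le_one_iff_eq_zero_or_eq_one.mp h₂ with rfl | rfl <;>
    rcases Nat.le_one_iff_eq_zero_or_eq_one.mp h₃ with rfl | rfl <;>
    rcases Nat.le_one_iff_eq_zero_or_eq_one.mp h₄ with rfl | rfl <;>
    rcases Int.units_eq_one_or σ with rfl | rfl
    · exact absurd ⟨rfl, rfl, rfl, rfl, rfl⟩ hne
    · exact cert_0000m_n4307 hβ hθI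
    · exact cert_0001p_n4307 hβ hθI
    · exact cert_0001m_n4307 hβ hθI
    · exact cert_0010p_n4307 hβ hθI
    · exact cert_0010m_n4307 hβ hθI
    · exact cert_0011p_n4307 hβ hθI
    · exact cert_0011m_n4307 hβ hθI
    · exact cert_0100p_n4307 hβ hθI
    · exact cert_0100m_n4307 hβ hθI
    · exact cert_0101p_n4307 hβ hθI
    · exact cert_0101m_n4307 hβ hθI
    · exact cert_0110p_n4307 hβ hθI
    · exact cert_0110m_n4307 hβ hθI
    · exact cert_0111p_n4307 hβ hθI
    · exact cert_0111m_n4307 hβ hθI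
    · exact cert_1000p_n4307 hβ hθI
    · exact cert_1000m_n4307 hβ hθI
    · exact cert_1001p_n4307 hβ hθI
    · exact cert_1001m_n4307 hβ hθI
    · exact cert_1010p_n4307 hβ hθI
    · exact cert_1010m_n4307 hβ hθI
    · exact cert_1011p_n4307 hβ hθI
    · exact cert_1011m_n4307 hβ hθI
    · exact cert_1100p_n4307 hβ hθI
    · exact cert_1100m_n4307 hβ hθI
    · exact cert_1101p_n4307 hβ hθI
    · exact cert_1101m_n4307 hβ hθI
    · exact cert_1110p_n4307 hβ hθI
    · exact cert_1110m_n4307 hβ hθI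
    · exact cert_1111p_n4307 hβ hθI
    · exact cert_1111m_n4307 hβ hθI
  exact classNumberPExp_one_eq_two_adjoin_of_orderFourCert_of_genusBit ((⟨1, 0, 0, -3, -4⟩ : WeierstrassCurve ℤ).baseChange ℚ) hord ht minimalDiscriminantInt_emod_eight_n4307 Δ_n4307_neg hβ
    (not_two_dvd_classNumber_cubicField_n4307 hβ) hd (Ideal.span {((-4 : 𝓞 ↥(IntermediateField.adjoin ℚ ({β} : Set (AlgebraicClosure ℚ)))) + (1 : 𝓞 ↥(IntermediateField.adjoin ℚ ({β} : Set (AlgebraicClosure ℚ)))) * θI + (0 : 𝓞 ↥(IntermediateField.adjoin ℚ ({β} : Set (AlgebraicClosure ℚ)))) * θI ^ 2)}) (absNorm_span_pi1_n4307 hβ) hε hnsq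
    (a₁ := ((1 : 𝓞 ↥(IntermediateField.adjoin ℚ ({β} : Set (AlgebraicClosure ℚ)))) + (0 : 𝓞 ↥(IntermediateField.adjoin ℚ ({β} : Set (AlgebraicClosure ℚ)))) * θI + (0 : 𝓞 ↥(IntermediateField.adjoin ℚ ({β} : Set (AlgebraicClosure ℚ)))) * θI ^ 2))
    (b₁ := ((1 : 𝓞 ↥(IntermediateField.adjoin ℚ ({β} : Set (AlgebraicClosure ℚ)))) + (0 : 𝓞 ↥(IntermediateField.adjoin ℚ ({β} : Set (AlgebraicClosure ℚ)))) * θI + (0 : 𝓞 ↥(IntermediateField.adjoin ℚ ({β} : Set (AlgebraicClosure ℚ)))) * θI ^ 2))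
    (c₁ := ((-1 : 𝓞 ↥(IntermediateField.adjoin ℚ ({β} : Set (AlgebraicClosure ℚ)))) + (0 : 𝓞 ↥(IntermediateField.adjoin ℚ ({β} : Set (AlgebraicClosure ℚ)))) * θI + (0 : 𝓞 ↥(IntermediateField.adjoin ℚ ({β} : Set (AlgebraicClosure ℚ)))) * θI ^ 2))
    (d₁ := ((1 : 𝓞 ↥(IntermediateField.adjoin ℚ ({β} : Set (AlgebraicClosure ℚ)))) + (0 : 𝓞 ↥(IntermediateField.adjoin ℚ ({β} : Set (AlgebraicClosure ℚ)))) * θI + (0 : 𝓞 ↥(IntermediateField.adjoin ℚ ({β} : Set (AlgebraicClosure ℚ)))) * θI ^ 2))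
    (a₂ := ((17 : 𝓞 ↥(IntermediateField.adjoin ℚ ({β} : Set (AlgebraicClosure ℚ)))) + (36 : 𝓞 ↥(IntermediateField.adjoin ℚ ({β} : Set (AlgebraicClosure ℚ)))) * θI + (124 : 𝓞 ↥(IntermediateField.adjoin ℚ ({β} : Set (AlgebraicClosure ℚ)))) * θI ^ 2))
    (b₂ := ((335 : 𝓞 ↥(IntermediateField.adjoin ℚ ({β} : Set (AlgebraicClosure ℚ)))) + (98 : 𝓞 ↥(IntermediateField.adjoin ℚ ({β} : Set (AlgebraicClosure ℚ)))) * θI + (48 : 𝓞 ↥(IntermediateField.adjoin ℚ ({β} : Set (AlgebraicClosure ℚ)))) * θI ^ 2))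
    (c₂ := ((-17 : 𝓞 ↥(IntermediateField.adjoin ℚ ({β} : Set (AlgebraicClosure ℚ)))) + (-36 : 𝓞 ↥(IntermediateField.adjoin ℚ ({β} : Set (AlgebraicClosure ℚ)))) * θI + (-124 : 𝓞 ↥(IntermediateField.adjoin ℚ ({β} : Set (AlgebraicClosure ℚ)))) * θI ^ 2))
    (d₂ := ((335 : 𝓞 ↥(IntermediateField.adjoin ℚ ({β} : Set (AlgebraicClosure ℚ)))) + (98 : 𝓞 ↥(IntermediateField.adjoin ℚ ({β} : Set (AlgebraicClosure ℚ)))) * θI + (48 : 𝓞 ↥(IntermediateField.adjoin ℚ ({β} : Set (AlgebraicClosure ℚ)))) * θI ^ 2))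
    (a₃ := ((175 : 𝓞 ↥(IntermediateField.adjoin ℚ ({β} : Set (AlgebraicClosure ℚ)))) + (60 : 𝓞 ↥(IntermediateField.adjoin ℚ ({β} : Set (AlgebraicClosure ℚ)))) * θI + (68 : 𝓞 ↥(IntermediateField.adjoin ℚ ({β} : Set (AlgebraicClosure ℚ)))) * θI ^ 2))
    (b₃ := ((-122 : 𝓞 ↥(IntermediateField.adjoin ℚ ({β} : Set (AlgebraicClosure ℚ)))) + (-45 : 𝓞 ↥(IntermediateField.adjoin ℚ ({β} : Set (AlgebraicClosure ℚ)))) * θI + (-48 : 𝓞 ↥(IntermediateField.adjoin ℚ ({β} : Set (AlgebraicClosure ℚ)))) * θI ^ 2))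
    (c₃ := ((-65 : 𝓞 ↥(IntermediateField.adjoin ℚ ({β} : Set (AlgebraicClosure ℚ)))) + (-304 : 𝓞 ↥(IntermediateField.adjoin ℚ ({β} : Set (AlgebraicClosure ℚ)))) * θI + (82 : 𝓞 ↥(IntermediateField.adjoin ℚ ({β} : Set (AlgebraicClosure ℚ)))) * θI ^ 2))
    (d₃ := ((46 : 𝓞 ↥(IntermediateField.adjoin ℚ ({β} : Set (AlgebraicClosure ℚ)))) + (215 : 𝓞 ↥(IntermediateField.adjoin ℚ ({β} : Set (AlgebraicClosure ℚ)))) * θI + (-58 : 𝓞 ↥(IntermediateField.adjoin ℚ ({β} : Set (AlgebraicClosure ℚ)))) * θI ^ 2))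
    (A := ((1 : 𝓞 ↥(IntermediateField.adjoin ℚ ({β} : Set (AlgebraicClosure ℚ)))) + (-2 : 𝓞 ↥(IntermediateField.adjoin ℚ ({β} : Set (AlgebraicClosure ℚ)))) * θI + (-1 : 𝓞 ↥(IntermediateField.adjoin ℚ ({β} : Set (AlgebraicClosure ℚ)))) * θI ^ 2))
    (B := ((-5 : 𝓞 ↥(IntermediateField.adjoin ℚ ({β} : Set (AlgebraicClosure ℚ)))) + (0 : 𝓞 ↥(IntermediateField.adjoin ℚ ({β} : Set (AlgebraicClosure ℚ)))) * θI + (-1 : 𝓞 ↥(IntermediateField.adjoin ℚ ({β} : Set (AlgebraicClosure ℚ)))) * θI ^ 2))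
    (W₀ := ((33751 : 𝓞 ↥(IntermediateField.adjoin ℚ ({β} : Set (AlgebraicClosure ℚ)))) + (61398 : 𝓞 ↥(IntermediateField.adjoin ℚ ({β} : Set (AlgebraicClosure ℚ)))) * θI + (-17911 : 𝓞 ↥(IntermediateField.adjoin ℚ ({β} : Set (AlgebraicClosure ℚ)))) * θI ^ 2))
    (W₁ := ((29315 : 𝓞 ↥(IntermediateField.adjoin ℚ ({β} : Set (AlgebraicClosure ℚ)))) + (43116 : 𝓞 ↥(IntermediateField.adjoin ℚ ({β} : Set (AlgebraicClosure ℚ)))) * θI + (-12945 : 𝓞 ↥(IntermediateField.adjoin ℚ ({β} : Set (AlgebraicClosure ℚ)))) * θI ^ 2))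
    (μ₀ := ((2511 : 𝓞 ↥(IntermediateField.adjoin ℚ ({β} : Set (AlgebraicClosure ℚ)))) + (-998 : 𝓞 ↥(IntermediateField.adjoin ℚ ({β} : Set (AlgebraicClosure ℚ)))) * θI + (91 : 𝓞 ↥(IntermediateField.adjoin ℚ ({β} : Set (AlgebraicClosure ℚ)))) * θI ^ 2))
    (μ₁ := ((-608 : 𝓞 ↥(IntermediateField.adjoin ℚ ({β} : Set (AlgebraicClosure ℚ)))) + (3518 : 𝓞 ↥(IntermediateField.adjoin ℚ ({β} : Set (AlgebraicClosure ℚ)))) * θI + (-860 : 𝓞 ↥(IntermediateField.adjoin ℚ ({β} : Set (AlgebraicClosure ℚ)))) * θI ^ 2))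
    (ν₀ := ((-450 : 𝓞 ↥(IntermediateField.adjoin ℚ ({β} : Set (AlgebraicClosure ℚ)))) + (-163 : 𝓞 ↥(IntermediateField.adjoin ℚ ({β} : Set (AlgebraicClosure ℚ)))) * θI + (-175 : 𝓞 ↥(IntermediateField.adjoin ℚ ({β} : Set (AlgebraicClosure ℚ)))) * θI ^ 2))
    (ν₁ := ((503 : 𝓞 ↥(IntermediateField.adjoin ℚ ({β} : Set (AlgebraicClosure ℚ)))) + (181 : 𝓞 ↥(IntermediateField.adjoin ℚ ({β} : Set (AlgebraicClosure ℚ)))) * θI + (196 : 𝓞 ↥(IntermediateField.adjoin ℚ ({β} : Set (AlgebraicClosure ℚ)))) * θI ^ 2))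
    (q₀ := ((-11 : 𝓞 ↥(IntermediateField.adjoin ℚ ({β} : Set (AlgebraicClosure ℚ)))) + (-5 : 𝓞 ↥(IntermediateField.adjoin ℚ ({β} : Set (AlgebraicClosure ℚ)))) * θI + (2 : 𝓞 ↥(IntermediateField.adjoin ℚ ({β} : Set (AlgebraicClosure ℚ)))) * θI ^ 2))
    (v₀ := ((-4 : 𝓞 ↥(IntermediateField.adjoin ℚ ({β} : Set (AlgebraicClosure ℚ)))) + (0 : 𝓞 ↥(IntermediateField.adjoin ℚ ({β} : Set (AlgebraicClosure ℚ)))) * θI + (0 : 𝓞 ↥(IntermediateField.adjoin ℚ ({β} : Set (AlgebraicClosure ℚ)))) * θI ^ 2))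
    (v₁ := ((1 : 𝓞 ↥(IntermediateField.adjoin ℚ ({β} : Set (AlgebraicClosure ℚ)))) + (0 : 𝓞 ↥(IntermediateField.adjoin ℚ ({β} : Set (AlgebraicClosure ℚ)))) * θI + (0 : 𝓞 ↥(IntermediateField.adjoin ℚ ({β} : Set (AlgebraicClosure ℚ)))) * θI ^ 2))
    (α₀ := ((48 : 𝓞 ↥(IntermediateField.adjoin ℚ ({β} : Set (AlgebraicClosure ℚ)))) + (19 : 𝓞 ↥(IntermediateField.adjoin ℚ ({β} : Set (AlgebraicClosure ℚ)))) * θI + (-8 : 𝓞 ↥(IntermediateField.adjoin ℚ ({β} : Set (AlgebraicClosure ℚ)))) * θI ^ 2))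
    (α₁ := ((-43 : 𝓞 ↥(IntermediateField.adjoin ℚ ({β} : Set (AlgebraicClosure ℚ)))) + (11 : 𝓞 ↥(IntermediateField.adjoin ℚ ({β} : Set (AlgebraicClosure ℚ)))) * θI + (0 : 𝓞 ↥(IntermediateField.adjoin ℚ ({β} : Set (AlgebraicClosure ℚ)))) * θI ^ 2))
    (β₀ := ((6 : 𝓞 ↥(IntermediateField.adjoin ℚ ({β} : Set (AlgebraicClosure ℚ)))) + (3 : 𝓞 ↥(IntermediateField.adjoin ℚ ({β} : Set (AlgebraicClosure ℚ)))) * θI + (2 : 𝓞 ↥(IntermediateField.adjoin ℚ ({β} : Set (AlgebraicClosure ℚ)))) * θI ^ 2))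
    (β₁ := ((2 : 𝓞 ↥(IntermediateField.adjoin ℚ ({β} : Set (AlgebraicClosure ℚ)))) + (0 : 𝓞 ↥(IntermediateField.adjoin ℚ ({β} : Set (AlgebraicClosure ℚ)))) * θI + (1 : 𝓞 ↥(IntermediateField.adjoin ℚ ({β} : Set (AlgebraicClosure ℚ)))) * θI ^ 2))
    (γ₀ := ((16 : 𝓞 ↥(IntermediateField.adjoin ℚ ({β} : Set (AlgebraicClosure ℚ)))) + (-27 : 𝓞 ↥(IntermediateField.adjoin ℚ ({β} : Set (AlgebraicClosure ℚ)))) * θI + (6 : 𝓞 ↥(IntermediateField.adjoin ℚ ({β} : Set (AlgebraicClosure ℚ)))) * θI ^ 2))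
    (γ₁ := ((8 : 𝓞 ↥(IntermediateField.adjoin ℚ ({β} : Set (AlgebraicClosure ℚ)))) + (21 : 𝓞 ↥(IntermediateField.adjoin ℚ ({β} : Set (AlgebraicClosure ℚ)))) * θI + (-6 : 𝓞 ↥(IntermediateField.adjoin ℚ ({β} : Set (AlgebraicClosure ℚ)))) * θI ^ 2))
    (δ₀ := ((22 : 𝓞 ↥(IntermediateField.adjoin ℚ ({β} : Set (AlgebraicClosure ℚ)))) + (7 : 𝓞 ↥(IntermediateField.adjoin ℚ ({β} : Set (AlgebraicClosure ℚ)))) * θI + (8 : 𝓞 ↥(IntermediateField.adjoin ℚ ({β} : Set (AlgebraicClosure ℚ)))) * θI ^ 2))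
    (δ₁ := ((4 : 𝓞 ↥(IntermediateField.adjoin ℚ ({β} : Set (AlgebraicClosure ℚ)))) + (2 : 𝓞 ↥(IntermediateField.adjoin ℚ ({β} : Set (AlgebraicClosure ℚ)))) * θI + (2 : 𝓞 ↥(IntermediateField.adjoin ℚ ({β} : Set (AlgebraicClosure ℚ)))) * θI ^ 2))
    (m₀ := ((1 : 𝓞 ↥(IntermediateField.adjoin ℚ ({β} : Set (AlgebraicClosure ℚ)))) + (2 : 𝓞 ↥(IntermediateField.adjoin ℚ ({β} : Set (AlgebraicClosure ℚ)))) * θI + (2 : 𝓞 ↥(IntermediateField.adjoin ℚ ({β} : Set (AlgebraicClosure ℚ)))) * θI ^ 2))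
    (m₁ := ((10 : 𝓞 ↥(IntermediateField.adjoin ℚ ({β} : Set (AlgebraicClosure ℚ)))) + (2 : 𝓞 ↥(IntermediateField.adjoin ℚ ({β} : Set (AlgebraicClosure ℚ)))) * θI + (1 : 𝓞 ↥(IntermediateField.adjoin ℚ ({β} : Set (AlgebraicClosure ℚ)))) * θI ^ 2))
    (n₀ := ((-7 : 𝓞 ↥(IntermediateField.adjoin ℚ ({β} : Set (AlgebraicClosure ℚ)))) + (-6 : 𝓞 ↥(IntermediateField.adjoin ℚ ({β} : Set (AlgebraicClosure ℚ)))) * θI + (-4 : 𝓞 ↥(IntermediateField.adjoin ℚ ({β} : Set (AlgebraicClosure ℚ)))) * θI ^ 2))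
    (n₁ := ((-7 : 𝓞 ↥(IntermediateField.adjoin ℚ ({β} : Set (AlgebraicClosure ℚ)))) + (-9 : 𝓞 ↥(IntermediateField.adjoin ℚ ({β} : Set (AlgebraicClosure ℚ)))) * θI + (7 : 𝓞 ↥(IntermediateField.adjoin ℚ ({β} : Set (AlgebraicClosure ℚ)))) * θI ^ 2))
    (l₀ := ((3 : 𝓞 ↥(IntermediateField.adjoin ℚ ({β} : Set (AlgebraicClosure ℚ)))) + (6 : 𝓞 ↥(IntermediateField.adjoin ℚ ({β} : Set (AlgebraicClosure ℚ)))) * θI + (-2 : 𝓞 ↥(IntermediateField.adjoin ℚ ({β} : Set (AlgebraicClosure ℚ)))) * θI ^ 2))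
    (l₁ := ((5 : 𝓞 ↥(IntermediateField.adjoin ℚ ({β} : Set (AlgebraicClosure ℚ)))) + (2 : 𝓞 ↥(IntermediateField.adjoin ℚ ({β} : Set (AlgebraicClosure ℚ)))) * θI + (-1 : 𝓞 ↥(IntermediateField.adjoin ℚ ({β} : Set (AlgebraicClosure ℚ)))) * θI ^ 2))
    (hu1_n4307 hβ hθI) (hu2_n4307 hβ hθI) (hu3_n4307 hβ hθI) (hws_n4307 hβ hθI) (hbez_n4307 hβ hθI) (q0_ne_zero_n4307 hβ hθI)
    (hM2_n4307 hβ hθI) (hM3_n4307 hβ hθI) (hM4_n4307 hβ hθI) hcert hNw hq κP hκP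

end Summit.BirchSwinnertonDyer.BirchSwinnertonDyer.Theorems.AlignedTransportAtTwoCubicOrderFourRowN4307

end
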